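import Mathlib
import Summits.Ventures.PercRepro.TriangleCapThirdGap

/-!
# PercRepro — THE SUB-BAND STRUCTURE THEOREM: THE TOP OF THE BAND ON `n` VERTICES DOWN TO ANY DEPTH (p3, gen 52;
part 260)

With `ℓ` non-neighbours of `w`, `t ≥ 4 u₀ + 3` off-edges and `ℓ + u₀ + 1 ≤ t`, every band value `2 j` either lies
in a sub-band `u ≤ u₀` — `u (t − u − 1) ≤ j` and `2 j + 2 q u ≤ 2 u (t − u − 1) + u (u + 1) + (ℓ − 1) q (q + 1)` for
every `q ≥ 1` — or satisfies `(u₀ + 1)(t − u₀ − 2) ≤ j` (`subband_structure`).  THE PROOF: take a vertex `x` of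
maximal off-degree `D = t − u`.  If `u ≤ u₀` then `D > ℓ`, so `x` is a non-neighbour of `w` (a neighbour carries at
most `ℓ` off-edges) and the two sub-band bounds of parts 252 and 257 apply; if `u₀ + 1 ≤ u ≤ t − u₀ − 2` the lower
bound is at least `(u₀ + 1)(t − u₀ − 2)` by concavity (`(u − u₀ − 1)(t − u − u₀ − 2) ≥ 0`); and if every off-degree
is `≤ u₀ + 1` then `offAdjPairs ≤ 2 u₀ t` and `2 j ≥ t (t − 1 − 2 u₀) ≥ 2 (u₀ + 1)(t − u₀ − 2)`.  The first, second and
third gaps (parts 253, 256, 259) are the cases `u₀ = 0, 1, 2` with their tangent bounds evaluated.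
Axioms: standard.
-/

namespace PercRepro

namespace TriangleCap

namespace C047

open Finset

variable {V : Type*} [Fintype V] [DecidableEq V]

/-- Every off-degree `≤ D + 1` ⇒ `offAdjPairs ≤ 2 D |F|`. -/
theorem offAdjPairs_le_of_offDeg_le (H : SimpleGraph V) [DecidableRel H.Adj] (w : V) (D : ℕ)
    (h : ∀ v, offDeg H w v ≤ D + 1) : offAdjPairs H w ≤ 2 * (D * (offEdges H w).card) := by
  rw [← sum_erase_offDeg_mul_pred]
  have hsum := sum_erase_offDeg H w
  have hle : ∑ v ∈ (univ : Finset V).erase w, offDeg H w v * (offDeg H w v - 1) ≤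
      ∑ v ∈ (univ : Finset V).erase w, D * offDeg H w v := by
    apply sum_le_sum
    intro v _
    have := h v
    calc offDeg H w v * (offDeg H w v - 1) ≤ offDeg H w v * D := Nat.mul_le_mul_left _ (by omega)
      _ = D * offDeg H w v := mul_comm _ _
  rw [← mul_sum, hsum] at hle
  calc _ ≤ D * (2 * (offEdges H w).card) := hle
    _ = 2 * (D * (offEdges H w).card) := by ring

/-- The concavity of the sub-band bottoms: `u₀ + 1 ≤ u`, `u + u₀ + 2 ≤ t` ⇒ `(u₀ + 1)(t − u₀ − 2) ≤ u (t − u − 1)`. -/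
theorem subband_bottom_concave (t u u₀ : ℕ) (hu1 : u₀ + 1 ≤ u) (hu2 : u + u₀ + 2 ≤ t) :
    (u₀ + 1) * (t - u₀ - 2) ≤ u * (t - u - 1) := by
  obtain ⟨a, rfl⟩ : ∃ a, u = u₀ + 1 + a := ⟨u - u₀ - 1, by omega⟩
  obtain ⟨b, rfl⟩ : ∃ b, t = u₀ + 1 + a + u₀ + 2 + b := ⟨t - (u₀ + 1 + a) - u₀ - 2, by omega⟩
  have e1 : u₀ + 1 + a + u₀ + 2 + b - u₀ - 2 = u₀ + 1 + a + b := by omega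
  have e2 : u₀ + 1 + a + u₀ + 2 + b - (u₀ + 1 + a) - 1 = u₀ + 1 + b := by omega
  rw [e1, e2]
  nlinarith

/-- The arithmetic of the small-degree regime: `t ≥ 4 u₀ + 3` ⇒ `2 (u₀ + 1)(t − u₀ − 2) ≤ t (t + 1) − 2 t − 2 u₀ t`
(stated without subtraction). -/
theorem small_degree_arith (t u₀ : ℕ) (ht : 4 * u₀ + 3 ≤ t) :
    2 * ((u₀ + 1) * (t - u₀ - 2)) + 2 * t + 2 * (u₀ * t) ≤ t * (t + 1) := by
  obtain ⟨r, rfl⟩ : ∃ r, t = 4 * u₀ + 3 + r := ⟨t - 4 * u₀ - 3, by omega⟩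
  have e : 4 * u₀ + 3 + r - u₀ - 2 = 3 * u₀ + 1 + r := by omega
  rw [e]
  nlinarith

/-- **THE SUB-BAND STRUCTURE THEOREM:** with `4 u₀ + 3 ≤ t` off-edges at `w` and `|nonNbrs| + u₀ + 1 ≤ t`, the band
value `2 j` lies in a sub-band `u ≤ u₀` (`u (t − u − 1) ≤ j` and the tangent bounds for every `q ≥ 1`) or satisfies
`(u₀ + 1)(t − u₀ − 2) ≤ j`. -/
theorem subband_structure (H : SimpleGraph V) [DecidableRel H.Adj] (hfree : H.CliqueFree 3) (s t j u₀ : ℕ)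
    (hs : H.edgeFinset.card = s) (w : V) (hw : 1 ≤ deg H w) (ht : (offEdges H w).card = t)
    (hj : ∑ v, deg H v * deg H v + 2 * (t * (s - t - 1)) + 2 * j = s * (s + 1)) (ht0 : 4 * u₀ + 3 ≤ t)
    (hℓ : (nonNbrs H w).card + u₀ + 1 ≤ t) :
    (∃ u, u ≤ u₀ ∧ u * (t - u - 1) ≤ j ∧ ∀ q, 1 ≤ q →
      2 * j + 2 * (q * u) ≤ 2 * (u * (t - u - 1)) + u * (u + 1) + ((nonNbrs H w).card - 1) * (q * (q + 1))) ∨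
    (u₀ + 1) * (t - u₀ - 2) ≤ j := by
  obtain ⟨x, -, hxmax⟩ := exists_max_image (univ : Finset V) (offDeg H w) ⟨w, mem_univ w⟩
  have hle := offDeg_le_card H w x
  rw [ht] at hle
  by_cases hcase : t ≤ offDeg H w x + u₀
  · -- the sub-band `u = t − offDeg x ≤ u₀`; `x` is a non-neighbour
    left
    have hxN : ¬ H.Adj w x := by
      intro hxN
      have := offDeg_le_card_nonNbrs_of_adj' H hfree w x hxN
      omega
    refine ⟨t - offDeg H w x, by omega, subband_lower_bound H hfree s t _ j hs w hw ht hj x (by omega),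
      fun q hq => subband_upper_bound H hfree s t _ j hs w hw ht hj x (by omega) hxN (by omega) q hq⟩
  · right
    by_cases hbig : u₀ + 2 ≤ offDeg H w x
    · -- `u₀ + 1 ≤ u ≤ t − u₀ − 2`: concavity
      have hb := subband_lower_bound H hfree s t (t - offDeg H w x) j hs w hw ht hj x (by omega)
      have := subband_bottom_concave t (t - offDeg H w x) u₀ (by omega) (by omega)
      omega
    · -- every off-degree `≤ u₀ + 1`
      have hall : ∀ v, offDeg H w v ≤ u₀ + 1 := fun v => by have := hxmax v (mem_univ v); omega
      have hval := (layer_value_iff H s t j hs w hw ht).mp hj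
      have hatt := attach_le H hfree w
      rw [ht] at hatt
      have hP := offAdjPairs_le_of_offDeg_le H w u₀ hall
      rw [ht] at hP
      have := small_degree_arith t u₀ ht0
      omega

/-- **THE SUB-BAND STRUCTURE THEOREM ON `n` VERTICES:** on `ℓ + 1 + (s − t)` vertices with `4 u₀ + 3 ≤ t` and
`ℓ + u₀ + 1 ≤ t`, every band value `2 j` of a vertex of degree `s − t ≥ 1` lies in a sub-band `u ≤ u₀` or has
`(u₀ + 1)(t − u₀ − 2) ≤ j`. -/
theorem subband_structure_vertices (ℓ s t : ℕ) (H : SimpleGraph (Fin (ℓ + 1 + (s - t)))) [DecidableRel H.Adj]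
    (hfree : H.CliqueFree 3) (hs : H.edgeFinset.card = s) (w : Fin (ℓ + 1 + (s - t))) (hw : deg H w + t = s)
    (hw1 : 1 ≤ deg H w) (u₀ j : ℕ) (ht0 : 4 * u₀ + 3 ≤ t) (hℓ : ℓ + u₀ + 1 ≤ t)
    (hj : ∑ v, deg H v * deg H v + 2 * (t * (s - t - 1)) + 2 * j = s * (s + 1)) :
    (∃ u, u ≤ u₀ ∧ u * (t - u - 1) ≤ j ∧ ∀ q, 1 ≤ q →
      2 * j + 2 * (q * u) ≤ 2 * (u * (t - u - 1)) + u * (u + 1) + (ℓ - 1) * (q * (q + 1))) ∨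
    (u₀ + 1) * (t - u₀ - 2) ≤ j := by
  have hc := card_nonNbrs_add H w
  rw [Fintype.card_fin] at hc
  have hcard := card_offEdges_add_deg H w
  have hℓ' : (nonNbrs H w).card = ℓ := by omega
  have := subband_structure H hfree s t j u₀ hs w hw1 (by omega) hj ht0 (by omega)
  rw [hℓ'] at this
  exact this

end C047

end TriangleCap

end PercRepro
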